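import Summits.Ventures.HodgeRepro2.A2PrimitivePart

/-!
# The Lefschetz decomposition of the model (A2 annex, sl₂ — part 3)

Iterating the primitive splitting of `A2LefschetzSplitting`: every `x ∈ ⋀^k`, `k ≤ n`, is

  `x = Σ_{j ≤ k/2} L^j v_j`,  `v_j ∈ ⋀^{k−2j}` primitive   (`exists_lefschetz_decomposition`),

and the components are unique (`lefschetz_decomposition_unique`) — Voisin's Prop. 6.22 / Cor. 6.26
as theorems of the twelve-plane model.  The Weil projection of `x` is that of `v_0`
(`weilProjModel_eq_of_lefschetz_decomposition`): all the other terms lie in the image of `L`.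
-/

namespace Summit.Ventures.HodgeRepro2.A2LefschetzDecomposition

open WeilPlanes WeilIntegral WeilCoproduct A2HardLefschetzOps A2HardLefschetzMain
  A2WeilProjection A2LefschetzSplitting A2PrimitivePart

variable {ι : Type*} [DecidableEq ι] [Fintype ι]

/-- **Existence of the Lefschetz decomposition**: every `x ∈ ⋀^k`, `k ≤ n`, is
`Σ_{j ≤ k/2} L^j v_j` with `v_j ∈ ⋀^{k−2j}` primitive. -/
theorem exists_lefschetz_decomposition {c : ι → ℂ} (hc : ∀ p, c p ≠ 0) (k : ℕ) :
    k ≤ Fintype.card ι → ∀ x ∈ grading ι k, ∃ v : ℕ → A ι,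
      (∀ j, v j ∈ grading ι (k - 2 * j)) ∧ (∀ j, lam c (v j) = 0) ∧
        x = ∑ j ∈ Finset.range (k / 2 + 1), (lef c ^ j) (v j) := by
  induction k using Nat.strong_induction_on with
  | _ k ih =>
    intro hk x hx
    by_cases hk2 : k < 2
    · refine ⟨fun j => if j = 0 then x else 0, fun j => ?_, fun j => ?_, ?_⟩
      · by_cases hj : j = 0
        · subst hj; simpa using hx
        · simp [hj]
      · by_cases hj : j = 0
        · subst hj; simpa using lam_eq_zero_of_mem_lt_two c hk2 hx
        · simp [hj]
      · have h1 : k / 2 + 1 = 1 := by omega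
        rw [h1, Finset.sum_range_one]
        simp
    · obtain ⟨v₀, y, hv₀, hprim, hy, hxy⟩ := exists_primitive_splitting hc hk hx
      obtain ⟨w, hw, hwprim, hyw⟩ := ih (k - 2) (by omega) (by omega) y hy
      refine ⟨fun j => if j = 0 then v₀ else w (j - 1), fun j => ?_, fun j => ?_, ?_⟩
      · by_cases hj : j = 0
        · subst hj; simpa using hv₀
        · have := hw (j - 1)
          rw [show k - 2 - 2 * (j - 1) = k - 2 * j by omega] at this
          simpa [hj] using this
      · by_cases hj : j = 0
        · subst hj; simpa using hprim
        · simpa [hj] using hwprim (j - 1)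
      · rw [Finset.sum_range_succ', hxy]
        simp only [pow_zero, Module.End.one_apply, if_true, Nat.add_sub_cancel, Nat.succ_ne_zero,
          if_false]
        rw [add_comm]
        congr 1
        rw [hyw, show k / 2 = (k - 2) / 2 + 1 by omega, map_sum]
        refine Finset.sum_congr rfl fun j _ => ?_
        rw [pow_succ', Module.End.mul_apply]

/-- **Uniqueness of the Lefschetz decomposition**: if `Σ_{j ≤ k/2} L^j v_j = 0` with `v_j ∈ ⋀^{k−2j}`
primitive, then every `v_j`, `j ≤ k/2`, is zero. -/
theorem lefschetz_decomposition_unique {c : ι → ℂ} (hc : ∀ p, c p ≠ 0) (k : ℕ) :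
    k ≤ Fintype.card ι → ∀ v : ℕ → A ι, (∀ j, v j ∈ grading ι (k - 2 * j)) →
      (∀ j, lam c (v j) = 0) → ∑ j ∈ Finset.range (k / 2 + 1), (lef c ^ j) (v j) = 0 →
        ∀ j ≤ k / 2, v j = 0 := by
  induction k using Nat.strong_induction_on with
  | _ k ih =>
    intro hk v hv hprim hsum j hj
    by_cases hk2 : k < 2
    · have h1 : k / 2 + 1 = 1 := by omega
      rw [h1, Finset.sum_range_one] at hsum
      have hj0 : j = 0 := by omega
      subst hj0
      simpa using hsum
    · -- `v 0 + L y = 0` with `y = Σ_{j < k/2} L^j v_{j+1} ∈ ⋀^{k−2}`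
      set y : A ι := ∑ i ∈ Finset.range (k / 2), (lef c ^ i) (v (i + 1)) with hy
      have hymem : y ∈ grading ι (k - 2) := by
        refine Submodule.sum_mem _ fun i hi => ?_
        have hi' : i < k / 2 := Finset.mem_range.1 hi
        have := lef_pow_mem_grading c i (hv (i + 1))
        rwa [show k - 2 * (i + 1) + 2 * i = k - 2 by omega] at this
      have hsplit : v 0 + lef c y = 0 + lef c 0 := by
        rw [map_zero, add_zero, ← hsum, Finset.sum_range_succ', pow_zero, Module.End.one_apply,
          add_comm, hy, map_sum]
        congr 1
        refine Finset.sum_congr rfl fun i _ => ?_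
        rw [pow_succ', Module.End.mul_apply]
      obtain ⟨hv0, hy0⟩ := primitive_splitting_unique hc (by omega) hk (hprim 0) (map_zero _)
        hymem (Submodule.zero_mem _) hsplit
      by_cases hj0 : j = 0
      · subst hj0; exact hv0
      · have hrec := ih (k - 2) (by omega) (by omega) (fun i => v (i + 1)) (fun i => ?_)
          (fun i => hprim (i + 1)) ?_ (j - 1) (by omega)
        · rwa [show j - 1 + 1 = j by omega] at hrec
        · have := hv (i + 1)
          rwa [show k - 2 * (i + 1) = k - 2 - 2 * i by omega] at this
        · rw [show (k - 2) / 2 + 1 = k / 2 by omega]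
          exact hy0

/-- **The Weil projection of a Lefschetz decomposition is that of the primitive term `v_0`**. -/
theorem weilProjModel_eq_of_lefschetz_decomposition (c : ι → ℂ) (W : Finset (Finset ι × Bool))
    (k : ℕ) (v : ℕ → A ι) :
    weilProjModel W (∑ j ∈ Finset.range (k / 2 + 1), (lef c ^ j) (v j)) = weilProjModel W (v 0) := by
  rw [Finset.sum_range_succ', pow_zero, Module.End.one_apply, weilProjModel_add]
  have h0 : weilProjModel W (∑ j ∈ Finset.range (k / 2), (lef c ^ (j + 1)) (v (j + 1))) = 0 := by
    have : (∑ j ∈ Finset.range (k / 2), (lef c ^ (j + 1)) (v (j + 1))) =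
        theta c * ∑ j ∈ Finset.range (k / 2), (lef c ^ j) (v (j + 1)) := by
      rw [Finset.mul_sum]
      refine Finset.sum_congr rfl fun j _ => ?_
      rw [pow_succ', Module.End.mul_apply]
      rfl
    rw [this, weilProjModel_theta_mul]
  rw [h0, zero_add]

/-- **Primitivity is being killed by `L^{n−k+1}`** (Voisin's two definitions of a primitive class
agree in the model): for `v ∈ ⋀^k`, `2 ≤ k ≤ n`, `Λ v = 0 ⇔ L^{n−k+1} v = 0`. -/
theorem lam_eq_zero_iff_lef_pow_succ_eq_zero {c : ι → ℂ} (hc : ∀ p, c p ≠ 0) {k : ℕ} (hk2 : 2 ≤ k)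
    (hk : k ≤ Fintype.card ι) {v : A ι} (hv : v ∈ grading ι k) :
    lam c v = 0 ↔ (lef c ^ (Fintype.card ι - k + 1)) v = 0 := by
  constructor
  · exact lef_pow_succ_eq_zero_of_primitive hc hk hv
  · intro h
    obtain ⟨v₀, y, hv₀, hprim, hy, hvy⟩ := exists_primitive_splitting hc hk hv
    have h0 := lef_pow_succ_eq_zero_of_primitive hc hk hv₀ hprim
    rw [hvy, map_add, h0, zero_add, ← Module.End.mul_apply, ← pow_succ] at h
    have hy0 : y = 0 :=
      eq_zero_of_lef_pow_eq_zero hc hy (m := Fintype.card ι - k + 1 + 1) (by omega) h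
    rw [hvy, hy0, map_zero, add_zero]
    exact hprim

end Summit.Ventures.HodgeRepro2.A2LefschetzDecomposition
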